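import Mathlib.LinearAlgebra.Dual.Lemmas
import Mathlib.LinearAlgebra.Dual.BaseChange
import Mathlib.Algebra.Algebra.Subalgebra.Centralizer
import Mathlib.RingTheory.IsTensorProduct
import Mathlib.RingTheory.Adjoin.Tower
import Literature.LinearAlgebra.BaseChange.EndomorphismAlgebraImageBaseChange
import HarnessLib

/-!
# Transport of the dimension identity `dim Z(S) · dim S = (dim W)²` along base changes, conjugations and blocks

Topic `Literature/LinearAlgebra/BaseChange` (namespace `Literature.LinearAlgebra.BaseChange`), sequel of ★
`EndomorphismAlgebraImageBaseChange` («(B-link)»: `finrank_center_mul_finrank_range_eq_sq_iff`).  THEOREMS ONLY (Mathlib + that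
file; no definition, no named fact, no instance, no `sorry`).

PRINTED RESULTS.  N. Bourbaki, *Algebra I, Chapters 1–3* (Springer 1989): Ch. II §5 no. 1 PROPOSITION 4 (p0379) — a basis of `E` gives a
basis of `E_(B)` («if `(a_λ)` is a basis of `E`, `(1 ⊗ a_λ)` is a basis of `E_(B)`»), whence `dim` is preserved and a linear map sending a
basis to a basis IS an extension of scalars; Ch. II §5 no. 3 PROPOSITION 7 (ii) (p0382) — `B ⊗_A End_A(E) → End_B(E_(B))` is bijective for
`E` finite free; Ch. III §4 no. 4 PROPOSITION 6 and COROLLARY (p0569) — centralisers and centres commute with `K ⊗_k −`.  These are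
the content of ★ (B-link); the present file adds only the functoriality that lets a CONSUMER holding an ABSTRACT base change
`j : V → W` (Mathlib `IsBaseChange L j`, e.g. the Betti–étale comparison `H₁ → V_ℓ` of ★ `Liu2021/AppendixC/H1ComparisonFamilyHolds`)
and intertwined families of endomorphisms use it:

* §1 (G1) along a bijective algebra homomorphism `θ : A → B`: `C(θ S) = θ C(S)` (`centralizer_map_eq_map_centralizer`), and the ranks
  of `S` and of its centre `S ⊓ C(S)` are preserved (`finrank_map_eq_of_injective`, `finrank_center_map_eq_of_bijective`).
* §2 (G-main) along a base change `j : V → W` to `L ⊇ k`: for families `act i ∈ End_k V`, `act' i ∈ End_L W` with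
  `act' i ∘ j = j ∘ act i`, writing `S := k⟨act⟩`, `S' := L⟨act'⟩` (`Algebra.adjoin`),
  **`dim_L Z(S') · dim_L S' = (dim_L W)² ↔ dim_k Z(S) · dim_k S = (dim_k V)²`**
  (`finrank_center_mul_finrank_adjoin_eq_sq_iff_of_isBaseChange`): conjugate by the isomorphism `L ⊗_k V ≃ W` of the base
  change (Mathlib `IsBaseChange.equiv`, `LinearEquiv.conjAlgEquiv`), identify `θ((1 ⊗ ρ)(L ⊗ S))` with `L⟨act'⟩`, apply §1 and (B-link).
  The families need not be multiplicative (transposed = anti-multiplicative actions are allowed).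
* §3 (G-block) the base change RESTRICTS TO BLOCKS: if `f' ∘ j = j ∘ f`, then `L · j(range f) = range f'` and the induced map
  `range f → range f'` (in any injective models) is a base change to `L` (`span_image_range_eq_range`, `isBaseChange_of_block`);
  and `j^∨ := IsBaseChange.toDual` intertwines the transposes (`toDual_dualMap_apply`) — with Mathlib `IsBaseChange.dual` the dual
  side is again §2.

DICTIONARY LINE (cell `hodgecm-mathlib`, crux `HLiu418` = stmt-HodgeConjecture-24832, d6 S2′ degree road, piece (D3), census
`A-provers/A-p08/CENSUS-S2prime-D3-comparison.A-p08g12.md`): `k := ℚ`, `L := ℚ̄_ℓ`, `V :=` the `ε`-block of the rational representation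
in `H¹`-variance, `W :=` the `ε`-block of `ℚ̄_ℓ ⊗ (V_ℓ A_K)^∨`, `j :=` the Betti–étale comparison, `act/act' :=` the Hecke algebra;
the left side of §2 is delivered on the ℓ-adic side by ★ `MultiplicityFreeImage` («(B-mf)», multiplicity one), the right side is the
hypothesis `hdim` of ★ `EndomorphismAlgebraFullOverCentralField` («(R-split)»).  The file moves no book (HC_CM is proved only modulo
the 7 printed citations until rung 0 closes).

## References
* [BourbakiAlgebraI1989] N. Bourbaki, *Algebra I, Chapters 1–3*, Springer (1989): Ch. II §5 no. 1 Prop. 4 (p0379), no. 3 Prop. 7 (ii)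
  (p0382); Ch. III §4 no. 4 Prop. 6 and Corollary (p0569); Ch. II §1 no. 13 (transport of structure along isomorphisms).
* [Lang2002] S. Lang, *Algebra*, 3rd ed. (2002), XVI §4 (extension of the base), XVII §1 (matrices and linear maps, conjugation).
-/

set_option autoImplicit false

open Module
open scoped TensorProduct

namespace Literature.LinearAlgebra.BaseChange

/-! ## §1 Transport along a bijective algebra homomorphism -/

section Map

variable {R A B : Type*} [CommSemiring R] [Semiring A] [Semiring B] [Algebra R A] [Algebra R B]

/-- **Centralisers are transported along a bijective algebra homomorphism: `C(θ S) = θ C(S)`.**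
[cite: BourbakiAlgebraI1989, Ch. II §1 no. 13 (transport of structure) and Ch. III §4 no. 4 (p0569)] -/
theorem centralizer_map_eq_map_centralizer (θ : A →ₐ[R] B) (hθ : Function.Bijective θ) (S : Subalgebra R A) :
    Subalgebra.centralizer R ((S.map θ : Subalgebra R B) : Set B) = (Subalgebra.centralizer R (S : Set A)).map θ := by
  ext y
  rw [Subalgebra.mem_centralizer_iff, Subalgebra.mem_map]
  constructor
  · intro hy
    obtain ⟨x, rfl⟩ := hθ.2 y
    refine ⟨x, (Subalgebra.mem_centralizer_iff R).2 fun a ha => hθ.1 ?_, rfl⟩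
    rw [map_mul, map_mul]
    exact hy (θ a) ⟨a, ha, rfl⟩
  · rintro ⟨x, hx, rfl⟩ b hb
    obtain ⟨a, ha, rfl⟩ := Subalgebra.mem_map.1 hb
    rw [← map_mul, ← map_mul, (Subalgebra.mem_centralizer_iff R).1 hx a ha]

/-- **An injective algebra homomorphism preserves the rank of a subalgebra: `rk θ(S) = rk S`.**
[cite: BourbakiAlgebraI1989, Ch. II §1 no. 13 (transport of structure)] -/
theorem finrank_map_eq_of_injective (θ : A →ₐ[R] B) (hθ : Function.Injective θ) (S : Subalgebra R A) :
    finrank R ↥(S.map θ) = finrank R ↥S :=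
  ((S.equivMapOfInjective θ hθ).toLinearEquiv.finrank_eq).symm

/-- **A bijective algebra homomorphism preserves the rank of the centre `S ⊓ C(S)` of a subalgebra.**
[cite: BourbakiAlgebraI1989, Ch. II §1 no. 13 (transport of structure) and Ch. III §4 no. 4 Corollary (p0569)] -/
theorem finrank_center_map_eq_of_bijective (θ : A →ₐ[R] B) (hθ : Function.Bijective θ) (S : Subalgebra R A) :
    finrank R ↥(S.map θ ⊓ Subalgebra.centralizer R ((S.map θ : Subalgebra R B) : Set B)) =
      finrank R ↥(S ⊓ Subalgebra.centralizer R (S : Set A)) := by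
  rw [centralizer_map_eq_map_centralizer θ hθ, ← Algebra.map_inf _ hθ.1, finrank_map_eq_of_injective θ hθ.1]

end Map

/-! ## §2 Transport along a base change `j : V → W` -/

section BaseChange

variable {k L : Type*} [Field k] [Field L] [Algebra k L]
  {V : Type*} [AddCommGroup V] [Module k V]
  {W : Type*} [AddCommGroup W] [Module k W] [Module L W] [IsScalarTower k L W]
  {j : V →ₗ[k] W} (hj : IsBaseChange L j)

include hj in
/-- **The conjugate `e ∘ f_L ∘ e⁻¹` of the extension of scalars of `f ∈ End_k V` by the base-change isomorphism
`e : L ⊗_k V ≃ W` is THE endomorphism of `W` over `f`: it maps `j v` to `j (f v)`.**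
[cite: BourbakiAlgebraI1989, Ch. II §5 no. 1 (extension of scalars of a linear map, (3)) (p0379)] -/
theorem conjAlgEquiv_baseChange_apply (f : Module.End k V) (v : V) :
    (hj.equiv.conjAlgEquiv L (f.baseChange L)) (j v) = j (f v) := by
  rw [LinearEquiv.conjAlgEquiv_apply, LinearMap.comp_apply, LinearMap.comp_apply, LinearEquiv.coe_toLinearMap,
    LinearEquiv.coe_toLinearMap, IsBaseChange.equiv_symm_apply, LinearMap.baseChange_tmul, IsBaseChange.equiv_tmul, one_smul]

include hj in
/-- **Uniqueness: an `L`-endomorphism `f'` of `W` with `f' ∘ j = j ∘ f` IS the conjugated extension of scalars of `f`** (two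
`L`-linear maps agreeing on `j(V)` agree, Mathlib `IsBaseChange.algHom_ext`).
[cite: BourbakiAlgebraI1989, Ch. II §5 no. 1 Proposition 4 and (3) (p0379)] -/
theorem eq_conjAlgEquiv_baseChange_of_comp (f : Module.End k V) (f' : Module.End L W) (hff' : ∀ v, f' (j v) = j (f v)) :
    f' = hj.equiv.conjAlgEquiv L (f.baseChange L) :=
  hj.algHom_ext f' _ fun v => by rw [hff', conjAlgEquiv_baseChange_apply hj]

include hj in
/-- **(G-main) The dimension identity `dim Z(S)·dim S = (dim W)²` descends along a base change.**  For families of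
endomorphisms `act i` of `V` and `act' i` of `W` intertwined by `j` (`act' i ∘ j = j ∘ act i`), with `S := k⟨act i⟩ ⊆ End_k V` and
`S' := L⟨act' i⟩ ⊆ End_L W` (the subalgebras they generate): `dim_L Z(S')·dim_L S' = (dim_L W)² ↔ dim_k Z(S)·dim_k S = (dim_k V)²`,
centres taken as `S ⊓ C(S)`.  (Conjugation by `L ⊗_k V ≃ W` carries `(1 ⊗ ρ)(L ⊗_k S)` onto `S'`; then §1 and ★ (B-link).)
[cite: BourbakiAlgebraI1989, Ch. II §5 no. 3 Proposition 7 (ii) (p0382); Ch. III §4 no. 4 Proposition 6 and Corollary (p0569)] -/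
theorem finrank_center_mul_finrank_adjoin_eq_sq_iff_of_isBaseChange [FiniteDimensional k V] {I : Type*}
    (act : I → Module.End k V) (act' : I → Module.End L W) (hact : ∀ i v, act' i (j v) = j (act i v)) :
    finrank L ↥(Algebra.adjoin L (Set.range act') ⊓
          Subalgebra.centralizer L (Algebra.adjoin L (Set.range act') : Set (Module.End L W))) *
        finrank L ↥(Algebra.adjoin L (Set.range act')) = finrank L W ^ 2 ↔
      finrank k ↥(Algebra.adjoin k (Set.range act) ⊓
          Subalgebra.centralizer k (Algebra.adjoin k (Set.range act) : Set (Module.End k V))) *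
        finrank k ↥(Algebra.adjoin k (Set.range act)) = finrank k V ^ 2 := by
  classical
  -- the subalgebra generated over `k`, acting through its inclusion `ρ`
  set S : Subalgebra k (Module.End k V) := Algebra.adjoin k (Set.range act) with hS
  -- (B-link) for `ρ := S.val`: the identity over `L` for the image `φ(L ⊗ S)` in `End_L (L ⊗ V)` ↔ the identity over `k` for `S`
  have hlink := finrank_center_mul_finrank_range_eq_sq_iff_subalgebra (K := L) S
  -- the base-change isomorphism and the conjugation it induces
  set e : L ⊗[k] V ≃ₗ[L] W := hj.equiv with he
  set θ : Module.End L (L ⊗[k] V) ≃ₐ[L] Module.End L W := e.conjAlgEquiv L with hθ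
  set φ : L ⊗[k] ↥S →ₐ[L] Module.End L (L ⊗[k] V) :=
    (LinearMap.tensorProductEnd k L V).comp (Algebra.TensorProduct.map (AlgHom.id L L) S.val) with hφ
  -- `η f := θ (f_L)`, a `k`-algebra homomorphism `End_k V → End_L W` with `η f (j v) = j (f v)`
  set η : Module.End k V →ₐ[k] Module.End L W :=
    ((θ : Module.End L (L ⊗[k] V) ≃ₐ[L] Module.End L W).toAlgHom.restrictScalars k).comp
      (((LinearMap.tensorProductEnd k L V).restrictScalars k).comp
        (Algebra.TensorProduct.includeRight : Module.End k V →ₐ[k] L ⊗[k] Module.End k V)) with hη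
  have hη_apply : ∀ f : Module.End k V, η f = θ (f.baseChange L) := by
    intro f
    change θ (LinearMap.tensorProductEnd k L V ((1 : L) ⊗ₜ[k] f)) = θ (f.baseChange L)
    rw [Literature.Algebra.Lie.CentroidScalarExtension.tensorProductEnd_tmul, one_smul]
  have hη_act : ∀ i, η (act i) = act' i := by
    intro i
    rw [hη_apply, hθ, he]
    exact (eq_conjAlgEquiv_baseChange_of_comp hj (act i) (act' i) (hact i)).symm
  have hφ_tmul : ∀ (a : L) (s : ↥S), θ (φ (a ⊗ₜ[k] s)) = a • η (s : Module.End k V) := by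
    intro a s
    rw [hφ, tensorProductEnd_comp_map_tmul, map_smul, hη_apply]
    rfl
  -- the key identification: `θ (φ (L ⊗ S)) = L⟨act'⟩`
  have hrange : (φ.range).map (θ : Module.End L (L ⊗[k] V) ≃ₐ[L] Module.End L W).toAlgHom =
      Algebra.adjoin L (Set.range act') := by
    rw [← AlgHom.range_comp]
    apply le_antisymm
    · rintro _ ⟨x, rfl⟩
      induction x using TensorProduct.induction_on with
      | zero =>
        change θ (φ 0) ∈ Algebra.adjoin L (Set.range act')
        rw [map_zero, map_zero]
        exact Subalgebra.zero_mem _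
      | tmul a s =>
        change θ (φ (a ⊗ₜ[k] s)) ∈ Algebra.adjoin L (Set.range act')
        rw [hφ_tmul]
        refine Subalgebra.smul_mem _ ?_ a
        -- `η s ∈ η(S) = k⟨η(act)⟩ ≤ L⟨act'⟩`
        have hs : η (s : Module.End k V) ∈ (Algebra.adjoin k (Set.range act)).map η :=
          Subalgebra.mem_map.2 ⟨(s : Module.End k V), by rw [← hS]; exact s.2, rfl⟩
        rw [AlgHom.map_adjoin] at hs
        have hle : Algebra.adjoin k (η '' Set.range act) ≤ (Algebra.adjoin L (Set.range act')).restrictScalars k := by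
          refine Algebra.adjoin_le ?_
          rintro _ ⟨_, ⟨i, rfl⟩, rfl⟩
          change η (act i) ∈ Algebra.adjoin L (Set.range act')
          rw [hη_act]
          exact Algebra.subset_adjoin (Set.mem_range_self i)
        exact hle hs
      | add x y hx hy =>
        change θ (φ (x + y)) ∈ Algebra.adjoin L (Set.range act')
        rw [map_add, map_add]
        exact Subalgebra.add_mem _ hx hy
    · refine Algebra.adjoin_le ?_
      rintro _ ⟨i, rfl⟩
      have hi : act i ∈ S := Algebra.subset_adjoin (Set.mem_range_self i)
      refine ⟨(1 : L) ⊗ₜ[k] (⟨act i, hi⟩ : ↥S), ?_⟩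
      change θ (φ ((1 : L) ⊗ₜ[k] (⟨act i, hi⟩ : ↥S))) = act' i
      rw [hφ_tmul, one_smul]
      exact hη_act i
  -- transport by §1 along the bijective `θ`, and `dim_L W = dim_L (L ⊗ V)`
  have hθbij : Function.Bijective (θ : Module.End L (L ⊗[k] V) ≃ₐ[L] Module.End L W).toAlgHom := θ.bijective
  rw [← hrange, finrank_center_map_eq_of_bijective _ hθbij, finrank_map_eq_of_injective _ hθbij.1, ← e.finrank_eq]
  exact hlink

end BaseChange

/-! ## §3 Blocks and duals -/

section Block

variable {k L : Type*} [Field k] [Field L] [Algebra k L]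
  {V : Type*} [AddCommGroup V] [Module k V]
  {W : Type*} [AddCommGroup W] [Module k W] [Module L W] [IsScalarTower k L W]
  {j : V →ₗ[k] W} (hj : IsBaseChange L j)

include hj in
/-- **`range f' = L · j(range f)`** for endomorphisms `f` of `V` and `f'` of `W` intertwined by the base change `j`
(`f' ∘ j = j ∘ f`): images commute with extension of scalars. [cite: BourbakiAlgebraI1989, Ch. II §5 no. 1 (3) and Proposition 4 (p0379)] -/
theorem span_image_range_eq_range (f : Module.End k V) (f' : Module.End L W) (hff' : ∀ v, f' (j v) = j (f v)) :
    Submodule.span L (j '' (LinearMap.range f : Set V)) = LinearMap.range f' := by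
  apply le_antisymm
  · rw [Submodule.span_le]
    rintro _ ⟨_, ⟨v, rfl⟩, rfl⟩
    exact ⟨j v, hff' v⟩
  · rintro _ ⟨w, rfl⟩
    induction w using hj.inductionOn with
    | zero => rw [map_zero]; exact Submodule.zero_mem _
    | tmul v => rw [hff']; exact Submodule.subset_span ⟨f v, ⟨v, rfl⟩, rfl⟩
    | smul a w hw => rw [map_smul]; exact Submodule.smul_mem _ a hw
    | add w₁ w₂ h₁ h₂ => rw [map_add]; exact Submodule.add_mem _ h₁ h₂

include hj in
/-- **`dim_L (range f') = dim_k (range f)`** for intertwined `f`, `f'` (`f'` is the conjugate of `f_L`, whose range is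
`(range f)_(L)`). [cite: BourbakiAlgebraI1989, Ch. II §5 no. 1 Proposition 4 (p0379)] -/
theorem finrank_range_eq_of_comp [FiniteDimensional k V] (f : Module.End k V) (f' : Module.End L W)
    (hff' : ∀ v, f' (j v) = j (f v)) : finrank L ↥(LinearMap.range f') = finrank k ↥(LinearMap.range f) := by
  rw [eq_conjAlgEquiv_baseChange_of_comp hj f f' hff', LinearEquiv.conjAlgEquiv_apply, LinearMap.range_comp,
    LinearMap.range_comp, LinearEquiv.range, Submodule.map_top, LinearEquiv.finrank_map_eq, ← baseChange_range,
    finrank_baseChange_eq]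

/-- A linear map sending a `k`-basis to an `L`-basis is a base change (Mathlib `IsBaseChange.of_equiv` with the basis
isomorphism). [cite: BourbakiAlgebraI1989, Ch. II §5 no. 1 Proposition 4 (p0379)] -/
theorem isBaseChange_of_basis_eq {M N ι : Type*} [AddCommGroup M] [Module k M] [AddCommGroup N] [Module k N] [Module L N]
    [IsScalarTower k L N] (g : M →ₗ[k] N) (b : Module.Basis ι k M) (b' : Module.Basis ι L N) (h : ∀ i, b' i = g (b i)) :
    IsBaseChange L g := by
  refine IsBaseChange.of_equiv ((Algebra.TensorProduct.basis L b).equiv b' (Equiv.refl ι)) fun x => ?_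
  suffices hx : (((Algebra.TensorProduct.basis L b).equiv b' (Equiv.refl ι)).toLinearMap.restrictScalars k ∘ₗ
      TensorProduct.mk k L M 1) = g from LinearMap.congr_fun hx x
  refine b.ext fun i => ?_
  rw [LinearMap.comp_apply, LinearMap.coe_restrictScalars, TensorProduct.mk_apply, LinearEquiv.coe_toLinearMap,
    ← Algebra.TensorProduct.basis_apply, Module.Basis.equiv_apply, Equiv.refl_apply, h]

include hj in
/-- **(G-block) The base change restricts to blocks.**  If `f ∈ End_k V` and `f' ∈ End_L W` are intertwined by `j` and
`iV : Vε ↪ V`, `iW : Wε ↪ W` are injective models of `range f`, `range f'`, then the induced map `jε : Vε → Wε` (`iW ∘ jε = j ∘ iV`)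
is again a base change to `L`: a `k`-basis of `Vε` is mapped to a spanning family of `Wε` of the right cardinality.
[cite: BourbakiAlgebraI1989, Ch. II §5 no. 1 Proposition 4 (p0379)] -/
theorem isBaseChange_of_block [FiniteDimensional k V] {Vε : Type*} [AddCommGroup Vε] [Module k Vε] {Wε : Type*}
    [AddCommGroup Wε] [Module k Wε] [Module L Wε] [IsScalarTower k L Wε] (iV : Vε →ₗ[k] V) (hiV : Function.Injective iV)
    (iW : Wε →ₗ[L] W) (hiW : Function.Injective iW) (f : Module.End k V) (f' : Module.End L W)
    (hff' : ∀ v, f' (j v) = j (f v)) (hV : LinearMap.range iV = LinearMap.range f) (hW : LinearMap.range iW = LinearMap.range f')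
    (jε : Vε →ₗ[k] Wε) (hjε : ∀ x, iW (jε x) = j (iV x)) : IsBaseChange L jε := by
  haveI : FiniteDimensional k Vε := Module.Finite.of_injective iV hiV
  -- a `k`-basis of the block and its image
  set n := finrank k Vε with hn
  let bV : Module.Basis (Fin n) k Vε := Module.finBasis k Vε
  -- the image family spans `Wε`
  have hspan : ⊤ ≤ Submodule.span L (Set.range (fun i => jε (bV i))) := by
    intro w _
    -- `iW w ∈ range f' = L · j(range f) = L · j(iV Vε) = iW (L · jε Vε)`
    have hw : iW w ∈ Submodule.span L (j '' (LinearMap.range f : Set V)) := by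
      rw [span_image_range_eq_range hj f f' hff', ← hW]
      exact ⟨w, rfl⟩
    rw [← hV] at hw
    have himage : j '' (LinearMap.range iV : Set V) ⊆ Submodule.map (iW.restrictScalars L) (Submodule.span L (Set.range fun i => jε (bV i))) := by
      rintro _ ⟨_, ⟨x, rfl⟩, rfl⟩
      refine ⟨jε x, ?_, hjε x⟩
      rw [← bV.sum_repr x, map_sum]
      refine Submodule.sum_mem _ fun i _ => ?_
      rw [LinearMap.map_smul_of_tower, ← algebraMap_smul L (bV.repr x i) (jε (bV i))]
      exact Submodule.smul_mem _ _ (Submodule.subset_span ⟨i, rfl⟩)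
    have hw' := (Submodule.span_le.2 himage) hw
    obtain ⟨w', hw'mem, hw'eq⟩ := hw'
    rw [← hiW hw'eq]
    exact hw'mem
  -- dimension count: `dim_L Wε = dim_L range f' = dim_k range f = dim_k Vε = n`
  have hcard : Fintype.card (Fin n) = finrank L Wε := by
    rw [Fintype.card_fin, hn, ← LinearMap.finrank_range_of_inj hiV, ← LinearMap.finrank_range_of_inj hiW, hV, hW,
      finrank_range_eq_of_comp hj f f' hff']
  let bW : Module.Basis (Fin n) L Wε := basisOfTopLeSpanOfCardEqFinrank (fun i => jε (bV i)) hspan hcard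
  exact isBaseChange_of_basis_eq jε bV bW fun i => by
    rw [coe_basisOfTopLeSpanOfCardEqFinrank]

include hj in
/-- **(G-block, existence form) the induced base change of blocks exists**: with `f`, `f'` intertwined by `j` and injective
models `iV : Vε ↪ V` of `range f`, `iW : Wε ↪ W` of `range f'`, there is a (unique) `k`-linear `jε : Vε → Wε` over `j`
(`iW ∘ jε = j ∘ iV`), and it is a base change to `L`. [cite: BourbakiAlgebraI1989, Ch. II §5 no. 1 Proposition 4 (p0379)] -/
theorem exists_isBaseChange_block [FiniteDimensional k V] {Vε : Type*} [AddCommGroup Vε] [Module k Vε] {Wε : Type*}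
    [AddCommGroup Wε] [Module k Wε] [Module L Wε] [IsScalarTower k L Wε] (iV : Vε →ₗ[k] V) (hiV : Function.Injective iV)
    (iW : Wε →ₗ[L] W) (hiW : Function.Injective iW) (f : Module.End k V) (f' : Module.End L W)
    (hff' : ∀ v, f' (j v) = j (f v)) (hV : LinearMap.range iV = LinearMap.range f) (hW : LinearMap.range iW = LinearMap.range f') :
    ∃ jε : Vε →ₗ[k] Wε, (∀ x, iW (jε x) = j (iV x)) ∧ IsBaseChange L jε := by
  -- `j (iV x) ∈ range f' = range iW`
  have hmem : ∀ x, (j ∘ₗ iV) x ∈ (LinearMap.range iW).restrictScalars k := by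
    intro x
    obtain ⟨u, hu⟩ : iV x ∈ LinearMap.range f := hV ▸ ⟨x, rfl⟩
    rw [Submodule.restrictScalars_mem, hW, LinearMap.comp_apply, ← hu, ← hff']
    exact ⟨j u, rfl⟩
  let g : Vε →ₗ[k] ↥((LinearMap.range iW).restrictScalars k) := LinearMap.codRestrict _ (j ∘ₗ iV) hmem
  let e : ↥((LinearMap.range iW).restrictScalars k) ≃ₗ[L] Wε :=
    ((LinearMap.range iW).restrictScalarsEquiv k).trans (LinearEquiv.ofInjective iW hiW).symm
  have hjε : ∀ x, iW (((e.toLinearMap.restrictScalars k) ∘ₗ g) x) = j (iV x) := by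
    intro x
    have hx : (iW ((LinearEquiv.ofInjective iW hiW).symm ⟨j (iV x), hmem x⟩) : W) =
        ((LinearEquiv.ofInjective iW hiW) ((LinearEquiv.ofInjective iW hiW).symm ⟨j (iV x), hmem x⟩) : W) := rfl
    rw [LinearEquiv.apply_symm_apply] at hx
    exact hx
  exact ⟨(e.toLinearMap.restrictScalars k) ∘ₗ g, hjε,
    isBaseChange_of_block hj iV hiV iW hiW f f' hff' hV hW _ hjε⟩

include hj in
/-- **Duals: `j^∨ := hj.toDual : V^∨ → W^∨` intertwines the transposes** — `j^∨ (φ ∘ f) = (j^∨ φ) ∘ f'` when `f' ∘ j = j ∘ f`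
(both sides are `L`-linear forms on `W` agreeing on `j(V)`).  With Mathlib `IsBaseChange.dual` (`j^∨` is a base change for `V`
finite-dimensional) the dual side is again §2/§3. [cite: BourbakiAlgebraI1989, Ch. II §5 no. 4 (dual of an extension of scalars) (p0383)] -/
theorem toDual_dualMap_apply (f : Module.End k V) (f' : Module.End L W) (hff' : ∀ v, f' (j v) = j (f v))
    (φ : Module.Dual k V) : hj.toDual (f.dualMap φ) = f'.dualMap (hj.toDual φ) := by
  refine hj.algHom_ext _ _ fun v => ?_
  rw [IsBaseChange.toDual_comp_apply, LinearMap.dualMap_apply, LinearMap.dualMap_apply, hff',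
    IsBaseChange.toDual_comp_apply]

end Block

end Literature.LinearAlgebra.BaseChange
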